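import Summits.Schanuel.Schanuel.Theorems.DiophantineDichotomyDefs
import Literature.NumberTheory.DiophantineApproximation.ApproximationByAlgebraicNumbersProofs

/-!
# Negative lemmas for crux `KhovanskiiApproxType` (stmt-Schanuel-6116): load-bearing hypotheses
# and non-uniformity of the constants

Route `DiophantineDichotomy` (sub-problem `Schanuel/Schanuel`), crux
`Summit.Schanuel.Schanuel.Theses.DiophantineDichotomy.KhovanskiiApproxType`: *for `n ≥ 2` and every
free Khovanskii point `θ = (s, e^s) ∈ ℂ²ⁿ` with `ℚ`-linearly independent `s`, `∃ a < 1/(n−1), b, C > 0`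
with `‖γ − θ‖ ≥ exp(−C(dᵃ log H + dᵇ))` for every algebraic challenger `γ` of field degree `≤ d` whose
coordinates are roots of non-zero integer polynomials of degree `≤ d` and height `≤ H`.*
This file (refuter, `cdisprove` lane `Theorems/KhovanskiiApproxType/Negative/`) does NOT prove or
refute the crux. It proves, sorry-free:

* `not_approxTypeAt_const_one` — THE ENGINE: at `θ = (1,…,1, e,…,e)` (constant tuple `s ≡ 1`) there is
  no approximation type with `a < 1`: Diaz's theorem (Bugeaud 2004 Thm 8.11, proved in tree as
  `Literature.NumberTheory.DiophantineApproximation.Bugeaud2004_thm_8_11_holds`) gives challengers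
  `(1,…,1, α,…,α)` of quality `0.006(n log M(α) + deg α · log M)`, linear in the degree budget `n` at
  every large scale `M`, which beats `exp(−C(nᵃ log H + nᵇ))` once `C n^{max a 0} ≤ 0.003 n` and
  `log M ≫ C(n^{1+a} log 2 + nᵇ)`.
* (load-bearing hypotheses) `khovanskiiApproxType_false_without_twoLe` (`2 ≤ n` dropped: fails at
  `n = 0`), `khovanskiiApproxType_false_from_one` (`2 ≤ n` weakened to `1 ≤ n`: fails at the
  Hermite–Lindemann point `s = (1)`, where the typed bound is `a < 1/((1:ℝ)−1) = 0`),
  `khovanskiiApproxType_false_without_linIndep` (`LinearIndependent ℚ s` dropped: fails at `n = 2`,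
  `s = (1, 1)`, a non-degenerate zero of `z₁ − 1 = z₂ − 1 = 0`). Consequence for provers: linear
  independence must be used to produce TWO independent transcendental directions among the
  coordinates of `θ` — a measure driven by a single slot cannot reach any `a < 1`.
* (tightness, sibling file `Negative/NonUniform.lean`) the constants `(a, b, C)` cannot be chosen
  uniformly in the point.

Vocabulary: `IsFreeKhovanskii`, `ApproxTypeAt`, `khovanskiiApproxType_iff` (`Iff.rfl`: the crux is the
pointwise statement over free Khovanskii points) are IMPORTED from the line lead's accepted definitions
module `Theorems/DiophantineDichotomyDefs.lean`
(namespace `Summit.Schanuel.Schanuel.Cruxes.KhovanskiiApproxType.LwSmallHeight`). The refuter's work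
file with the near-misses is `Cruxes/KhovanskiiApproxType/Disproof.lean`.
-/

noncomputable section

set_option linter.dupNamespace false

namespace Summit.Schanuel.Schanuel.Cruxes.KhovanskiiApproxType.Negative

open Summit.Schanuel.Schanuel.Theses.DiophantineDichotomy (KhovanskiiApproxType)
open Summit.Schanuel.Schanuel.Cruxes.KhovanskiiApproxType.LwSmallHeight
open Polynomial
open Literature.NumberTheory.DiophantineApproximation (Bugeaud2004_thm_8_11_holds
  one_le_mahlerMeasure_map)

/-! ## Bookkeeping: heights, the degree choice in Diaz's theorem -/

/-- Naive height `max_k |coeff_k P|` of an integer polynomial, as a natural number. -/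
def natHeight (P : ℤ[X]) : ℕ := P.support.sup fun k => (P.coeff k).natAbs

/-- Every coefficient is bounded by the naive height. -/
theorem abs_coeff_le_natHeight (P : ℤ[X]) (k : ℕ) : |P.coeff k| ≤ (natHeight P : ℤ) := by
  by_cases hk : k ∈ P.support
  · have h : (P.coeff k).natAbs ≤ natHeight P :=
      Finset.le_sup (f := fun k => (P.coeff k).natAbs) hk
    calc |P.coeff k| = ((P.coeff k).natAbs : ℤ) := (Int.natCast_natAbs _).symm
      _ ≤ natHeight P := by exact_mod_cast h
  · rw [Polynomial.notMem_support_iff.mp hk, abs_zero]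
    positivity

/-- A non-zero integer polynomial has naive height `≥ 1`. -/
theorem one_le_natHeight (P : ℤ[X]) (hP : P ≠ 0) : 1 ≤ natHeight P := by
  have hmem : P.natDegree ∈ P.support := natDegree_mem_support_of_nonzero hP
  have h1 : 1 ≤ (P.coeff P.natDegree).natAbs :=
    Int.natAbs_pos.mpr (leadingCoeff_ne_zero.mpr hP)
  exact h1.trans (Finset.le_sup (f := fun k => (P.coeff k).natAbs) hmem)

/-- `H(P) ≤ 2^{deg P} M(P)` (binomial bound on the coefficients by the Mahler measure). -/
theorem natHeight_le (P : ℤ[X]) :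
    (natHeight P : ℝ) ≤ 2 ^ P.natDegree * (P.map (Int.castRingHom ℂ)).mahlerMeasure := by
  by_cases hP : P = 0
  · subst hP; simp [natHeight]
  obtain ⟨k, -, hk⟩ := Finset.exists_mem_eq_sup P.support (support_nonempty.mpr hP)
    (fun k => (P.coeff k).natAbs)
  unfold natHeight
  rw [hk]
  have h1 := norm_coeff_le_choose_mul_mahlerMeasure k (P.map (Int.castRingHom ℂ))
  rw [coeff_map, eq_intCast, Complex.norm_intCast,
    natDegree_map_eq_of_injective Int.cast_injective] at h1
  have h2 : ((P.coeff k).natAbs : ℝ) = |((P.coeff k : ℤ) : ℝ)| := by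
    rw [← Int.cast_natCast, Int.natCast_natAbs, Int.cast_abs]
  rw [h2]
  refine h1.trans ?_
  gcongr
  · exact mahlerMeasure_nonneg _
  · exact_mod_cast Nat.choose_le_two_pow _ _

/-- Choice of the degree in Diaz's theorem: for `a' < 1`, `C > 0` some `n ≥ 50` has
`C n^{a'} ≤ 0.003 n`. -/
theorem exists_deg (a' C : ℝ) (ha1 : a' < 1) (hC : 0 < C) :
    ∃ n : ℕ, 50 ≤ n ∧ C * (n : ℝ) ^ a' ≤ 3 / 1000 * n := by
  set T : ℝ := C / (3 / 1000) with hT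
  have hTpos : 0 < T := by positivity
  set e : ℝ := 1 / (1 - a') with he
  refine ⟨max 50 ⌈T ^ e⌉₊, le_max_left _ _, ?_⟩
  set n : ℕ := max 50 ⌈T ^ e⌉₊ with hn
  have hTn : T ^ e ≤ (n : ℝ) :=
    (Nat.le_ceil _).trans (by exact_mod_cast le_max_right 50 ⌈T ^ e⌉₊)
  have hnpos : (0 : ℝ) < n := by
    have : (50 : ℝ) ≤ n := by exact_mod_cast le_max_left 50 ⌈T ^ e⌉₊
    linarith
  have h1 : T ≤ (n : ℝ) ^ (1 - a') := by
    have h := Real.rpow_le_rpow (by positivity) hTn (by linarith : (0 : ℝ) ≤ 1 - a')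
    have hne : (1 - a') ≠ 0 := by linarith
    rwa [← Real.rpow_mul hTpos.le, show e * (1 - a') = 1 by
      rw [he, one_div, inv_mul_cancel₀ hne], Real.rpow_one] at h
  have hC' : C = 3 / 1000 * T := by rw [hT]; field_simp
  calc C * (n : ℝ) ^ a' = 3 / 1000 * (T * (n : ℝ) ^ a') := by rw [hC']; ring
    _ ≤ 3 / 1000 * ((n : ℝ) ^ (1 - a') * (n : ℝ) ^ a') := by gcongr
    _ = 3 / 1000 * n := by rw [← Real.rpow_add hnpos, sub_add_cancel, Real.rpow_one]



/-! ## The engine: Diaz's theorem beats every exponent `a < 1` along a single transcendental slot -/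

set_option maxHeartbeats 800000 in
/-- **Diaz's theorem kills every exponent `a < 1` at `θ = (1,…,1, e,…,e) ∈ ℂ²ᵐ` (every `m`; for `m = 0` trivially).**
For `s = (1, …, 1)` and any `a < 1`, `b`, `C > 0`, the challengers `γ = (1,…,1, α,…,α)` with `α` the
algebraic approximation of `e` of degree `≤ n` and Mahler measure `≤ M` from Bugeaud 2004 Thm 8.11
(= Diaz 1997; `Bugeaud2004_thm_8_11_holds`, PROVED in tree) beat the bound `exp(−C(dᵃ log H + dᵇ))`
with budget `d := n`, `H := H(minpoly α) ≤ 2ⁿ M(α)`: the quality `0.006(n log M(α) + deg α · log M)`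
is linear in `n` (choose `n` with `C n^{max a 0} ≤ 0.003 n`) and `M` is free at fixed `n`
(choose `log M > C(n^{1+a} log 2 + nᵇ)/0.006`). [cite: Bugeaud2004, Thm 8.11] -/
theorem not_approxTypeAt_const_one (m : ℕ) (a b C : ℝ) (ha : a < 1) :
    ¬ ApproxTypeAt m (fun _ => (1 : ℂ)) a b C := by
  rintro ⟨hC, hall⟩
  -- nonnegative exponents dominate
  set a' : ℝ := max a 0 with ha'
  set b' : ℝ := max b 0 with hb'
  have ha'1 : a' < 1 := max_lt ha one_pos
  obtain ⟨n, hn50, hn⟩ := exists_deg a' C ha'1 hC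
  have hn1nat : 1 ≤ n := le_trans (by norm_num) hn50
  have hn1 : (1 : ℝ) ≤ n := by exact_mod_cast hn1nat
  have hnpos : (0 : ℝ) < n := by linarith
  -- the M-independent slack and the choice of M
  set K0 : ℝ := C * ((n : ℝ) ^ a' * (n * Real.log 2) + (n : ℝ) ^ b') with hK0
  set ξ : ℂ := Complex.exp 1 with hξ
  set M : ℝ := max (max ((n : ℝ) + 1) ((4 + ‖ξ‖) ^ 100)) (Real.exp (K0 / (6 / 1000) + 1))
    with hMdef
  have hM1 : (n : ℝ) + 1 ≤ M := (le_max_left _ _).trans (le_max_left _ _)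
  have hM2 : (4 + ‖ξ‖) ^ 100 ≤ M := (le_max_right _ _).trans (le_max_left _ _)
  have hMpos : 0 < M := by linarith
  have hlogM : K0 / (6 / 1000) + 1 ≤ Real.log M := by
    rw [Real.le_log_iff_exp_le hMpos]
    exact le_max_right _ _
  -- Diaz / Bugeaud 8.11 at ξ = e
  obtain ⟨α, P, hPirr, hPα, hPdeg, hPM, hdist⟩ := Bugeaud2004_thm_8_11_holds ξ n M hn50 hM1 hM2
  have hP0 : P ≠ 0 := hPirr.ne_zero
  have hdP : 1 ≤ P.natDegree := by
    rw [Nat.one_le_iff_ne_zero]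
    intro h0
    have hc : P = Polynomial.C (P.coeff 0) := eq_C_of_natDegree_eq_zero h0
    rw [hc, aeval_C, algebraMap_int_eq, eq_intCast, Int.cast_eq_zero] at hPα
    exact hP0 (by rw [hc, hPα, map_zero])
  set MP : ℝ := (P.map (Int.castRingHom ℂ)).mahlerMeasure with hMP
  have hMP1 : 1 ≤ MP := one_le_mahlerMeasure_map P hP0
  have hlogMP : 0 ≤ Real.log MP := Real.log_nonneg hMP1
  -- the challenger γ = (1, 1, α, α) with budget d := n, H := natHeight P
  set H : ℕ := natHeight P with hHdef
  have hH1 : 1 ≤ H := one_le_natHeight P hP0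
  have hH1r : (1 : ℝ) ≤ H := by exact_mod_cast hH1
  set γ : Fin m ⊕ Fin m → ℂ := Sum.elim (fun _ => (1 : ℂ)) (fun _ => α) with hγ
  have hαint : IsIntegral ℚ α := by
    refine (show IsAlgebraic ℚ α from ⟨P.map (Int.castRingHom ℚ), ?_, ?_⟩).isIntegral
    · exact (Polynomial.map_ne_zero_iff (Int.castRingHom ℚ).injective_int).mpr hP0
    · rw [← algebraMap_int_eq, aeval_map_algebraMap]; exact hPα
  have hfr : Module.finrank ℚ ↥(IntermediateField.adjoin ℚ (Set.range γ)) ≤ n := by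
    have hle : IntermediateField.adjoin ℚ (Set.range γ) ≤ IntermediateField.adjoin ℚ {α} := by
      rw [IntermediateField.adjoin_le_iff]
      rintro _ ⟨i, rfl⟩
      rcases i with i | i
      · have : γ (Sum.inl i) = 1 := by simp [hγ]
        rw [this]; exact one_mem _
      · have : γ (Sum.inr i) = α := by simp [hγ]
        rw [this]; exact IntermediateField.mem_adjoin_simple_self ℚ α
    haveI : FiniteDimensional ℚ (IntermediateField.adjoin ℚ {α}) :=
      IntermediateField.adjoin.finiteDimensional hαint
    refine (IntermediateField.finrank_le_of_le_right hle).trans ?_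
    rw [IntermediateField.adjoin.finrank hαint]
    refine le_trans ?_ hPdeg
    have h := minpoly.degree_le_of_ne_zero ℚ α
      ((Polynomial.map_ne_zero_iff (Int.castRingHom ℚ).injective_int).mpr hP0)
      (by rw [← algebraMap_int_eq, aeval_map_algebraMap]; exact hPα)
    have h' := natDegree_le_natDegree h
    rwa [natDegree_map_eq_of_injective (Int.castRingHom ℚ).injective_int] at h'
  have hcl : ∀ i, ∃ Q : Polynomial ℤ, Q ≠ 0 ∧ Q.natDegree ≤ n ∧ (∀ k, |Q.coeff k| ≤ (H : ℤ)) ∧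
      Polynomial.aeval (γ i) Q = 0 := by
    rintro (i | i)
    · refine ⟨X - Polynomial.C 1, X_sub_C_ne_zero 1, ?_, ?_, ?_⟩
      · rw [natDegree_X_sub_C]; exact hn1nat
      · intro k
        have hH1z : (1 : ℤ) ≤ H := by exact_mod_cast hH1
        rw [coeff_sub, coeff_X, coeff_C]
        split_ifs <;> simp <;> omega
      · have : γ (Sum.inl i) = 1 := by simp [hγ]
        simp [this]
    · refine ⟨P, hP0, hPdeg, abs_coeff_le_natHeight P, ?_⟩
      have : γ (Sum.inr i) = α := by simp [hγ]
      rw [this]; exact hPα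
  have key := hall n H γ hfr hcl
  -- the distance is |e - α|
  have hdist' : ‖γ - Sum.elim (fun _ : Fin m => (1 : ℂ)) (Complex.exp ∘ fun _ : Fin m => (1 : ℂ))‖ ≤
      ‖ξ - α‖ := by
    refine (pi_norm_le_iff_of_nonneg (norm_nonneg _)).mpr ?_
    rintro (i | i)
    · simp [hγ]
    · simp [hγ, hξ, norm_sub_rev]
  -- height bookkeeping: log H ≤ n log 2 + log M(P)
  have hlogH : Real.log H ≤ n * Real.log 2 + Real.log MP := by
    have h1 : (H : ℝ) ≤ 2 ^ P.natDegree * MP := natHeight_le P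
    have h2 : (2 : ℝ) ^ P.natDegree ≤ 2 ^ n := pow_le_pow_right₀ (by norm_num) hPdeg
    have h3 : (H : ℝ) ≤ 2 ^ n * MP := h1.trans (by gcongr)
    calc Real.log H ≤ Real.log (2 ^ n * MP) := Real.log_le_log (by positivity) h3
      _ = n * Real.log 2 + Real.log MP := by
        rw [Real.log_mul (by positivity) (by positivity), Real.log_pow]
  -- exponent bookkeeping
  have hna : (n : ℝ) ^ a ≤ (n : ℝ) ^ a' := Real.rpow_le_rpow_of_exponent_le hn1 (le_max_left _ _)
  have hnb : (n : ℝ) ^ b ≤ (n : ℝ) ^ b' := Real.rpow_le_rpow_of_exponent_le hn1 (le_max_left _ _)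
  have hlogH0 : 0 ≤ Real.log H := Real.log_nonneg hH1r
  have hna'0 : 0 ≤ (n : ℝ) ^ a' := by positivity
  have hLHS : C * ((n : ℝ) ^ a * Real.log H + (n : ℝ) ^ b) ≤
      3 / 1000 * ((n : ℝ) * Real.log MP) + K0 := by
    have step : C * (n : ℝ) ^ a' * Real.log MP ≤ 3 / 1000 * n * Real.log MP :=
      mul_le_mul_of_nonneg_right hn hlogMP
    calc C * ((n : ℝ) ^ a * Real.log H + (n : ℝ) ^ b)
        ≤ C * ((n : ℝ) ^ a' * Real.log H + (n : ℝ) ^ b') := by gcongr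
      _ ≤ C * ((n : ℝ) ^ a' * (n * Real.log 2 + Real.log MP) + (n : ℝ) ^ b') := by gcongr
      _ = C * (n : ℝ) ^ a' * Real.log MP + K0 := by rw [hK0]; ring
      _ ≤ 3 / 1000 * n * Real.log MP + K0 := by linarith
      _ = 3 / 1000 * ((n : ℝ) * Real.log MP) + K0 := by ring
  have hKM : K0 < 6 / 1000 * Real.log M := by
    have h6 : (6 / 1000 : ℝ) * (K0 / (6 / 1000)) = K0 := by field_simp
    have h := mul_le_mul_of_nonneg_left hlogM (by norm_num : (0 : ℝ) ≤ 6 / 1000)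
    rw [mul_add, h6] at h
    linarith
  have hX0 : 0 ≤ (n : ℝ) * Real.log MP := by positivity
  have hlM : 0 ≤ Real.log M := by
    have hK0nn : 0 ≤ K0 := by rw [hK0]; positivity
    linarith
  have hY : Real.log M ≤ (P.natDegree : ℝ) * Real.log M :=
    le_mul_of_one_le_left hlM (by exact_mod_cast hdP)
  have hgap : C * ((n : ℝ) ^ a * Real.log H + (n : ℝ) ^ b) <
      6 / 1000 * ((n : ℝ) * Real.log MP + (P.natDegree : ℝ) * Real.log M) := by
    linarith
  -- contradiction
  have hchain : Real.exp (-(C * ((n : ℝ) ^ a * Real.log H + (n : ℝ) ^ b))) ≤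
      Real.exp (-(6 / 1000 * ((n : ℝ) * Real.log MP + (P.natDegree : ℝ) * Real.log M))) :=
    key.trans (hdist'.trans hdist)
  rw [Real.exp_le_exp] at hchain
  linarith


/-! ## (a) Load-bearing hypotheses -/

/-- The crux with `2 ≤ n` DROPPED. -/
def KhovanskiiApproxTypeWithoutTwoLe : Prop :=
  ∀ (n : ℕ) (s : Fin n → ℂ), LinearIndependent ℚ s →
    IsFreeKhovanskii n s → ∃ a b C : ℝ, a < 1 / ((n : ℝ) - 1) ∧ ApproxTypeAt n s a b C

/-- The crux with `2 ≤ n` WEAKENED to `1 ≤ n`. -/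
def KhovanskiiApproxTypeFromOne : Prop :=
  ∀ (n : ℕ) (s : Fin n → ℂ), 1 ≤ n → LinearIndependent ℚ s →
    IsFreeKhovanskii n s → ∃ a b C : ℝ, a < 1 / ((n : ℝ) - 1) ∧ ApproxTypeAt n s a b C

/-- The crux with `LinearIndependent ℚ s` DROPPED. -/
def KhovanskiiApproxTypeWithoutLinIndep : Prop :=
  ∀ (n : ℕ) (s : Fin n → ℂ), 2 ≤ n →
    IsFreeKhovanskii n s → ∃ a b C : ℝ, a < 1 / ((n : ℝ) - 1) ∧ ApproxTypeAt n s a b C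

/-- Sanity: restoring the dropped hypothesis re-assembles the crux. -/
theorem khovanskiiApproxType_of_without (h : KhovanskiiApproxTypeWithoutLinIndep) :
    KhovanskiiApproxType :=
  khovanskiiApproxType_iff.mpr fun n s hn _ hK => h n s hn hK

/-- The constant tuple `s = (1, …, 1) ∈ ℂⁿ` is a non-degenerate zero of the Khovanskii system
`zᵢ − 1 = 0`: the exponential Jacobian is the identity matrix. (For `n ≥ 2` it is ℚ-linearly
DEPENDENT; for `n = 1` it is the Hermite–Lindemann point `θ = (1, e)`; for `n = 0` it is empty.) -/
theorem isFreeKhovanskii_const_one (n : ℕ) : IsFreeKhovanskii n (fun _ => (1 : ℂ)) := by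
  classical
  refine ⟨fun i => MvPolynomial.X (Sum.inl i) - 1, ?_, ?_⟩
  · intro i
    simp
  · have : (Matrix.of fun i j => MvPolynomial.aeval (Sum.elim (fun _ : Fin n => (1 : ℂ))
        (Complex.exp ∘ fun _ : Fin n => (1 : ℂ)))
        (MvPolynomial.pderiv (Sum.inl j) (MvPolynomial.X (Sum.inl i) - 1) +
          MvPolynomial.X (Sum.inr j) *
            MvPolynomial.pderiv (Sum.inr j) (MvPolynomial.X (Sum.inl i) - 1 :
              MvPolynomial (Fin n ⊕ Fin n) ℚ))) = 1 := by
      ext i j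
      by_cases hij : i = j
      · subst hij; simp [MvPolynomial.pderiv_X, Pi.single_apply]
      · simp [MvPolynomial.pderiv_X, Pi.single_apply, hij]
    rw [this, Matrix.det_one]
    exact one_ne_zero

/-- At `n = 0` no approximation type exists at all: the (unique, empty) challenger `γ = θ = ()`
is admissible with `d = H = 1` and has distance `0 < exp(−C(1ᵃ·0 + 1ᵇ))`. [folklore] -/
theorem not_approxTypeAt_zero (s : Fin 0 → ℂ) (a b C : ℝ) : ¬ ApproxTypeAt 0 s a b C := by
  rintro ⟨-, h⟩
  have h1 := h 1 1 (fun _ => 0) ?_ ?_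
  · have : ‖(fun _ : Fin 0 ⊕ Fin 0 => (0 : ℂ)) - Sum.elim s (Complex.exp ∘ s)‖ = 0 := by
      rw [norm_eq_zero]; exact Subsingleton.elim _ _
    rw [this] at h1
    exact absurd h1 (not_le.mpr (Real.exp_pos _))
  · have hr : Set.range (fun _ : Fin 0 ⊕ Fin 0 => (0 : ℂ)) = ∅ := Set.range_eq_empty _
    rw [hr, IntermediateField.adjoin_empty, IntermediateField.finrank_bot]
  · intro i; exact (IsEmpty.false i).elim

/-- **`2 ≤ n` is load-bearing (trivially): with it dropped the crux fails at `n = 0`.** -/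
theorem khovanskiiApproxType_false_without_twoLe : ¬ KhovanskiiApproxTypeWithoutTwoLe := by
  intro h
  obtain ⟨a, b, C, -, hAT⟩ := h 0 (fun _ => 1) linearIndependent_empty_type
    (isFreeKhovanskii_const_one 0)
  exact not_approxTypeAt_zero _ a b C hAT

/-- **`2 ≤ n` cannot be weakened to `1 ≤ n`:** at the Hermite–Lindemann point `s = (1)` the typed
exponent bound is `a < 1/((1:ℝ) − 1) = 0 < 1`, and Diaz beats every `a < 1` (so the failure is
not only the `1/0 = 0` junk: the informal `n = 1` statement "some `a < 1`" is false too). -/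
theorem khovanskiiApproxType_false_from_one : ¬ KhovanskiiApproxTypeFromOne := by
  intro h
  have hli : LinearIndependent ℚ (fun _ : Fin 1 => (1 : ℂ)) := by
    rw [linearIndependent_unique_iff]; exact one_ne_zero
  obtain ⟨a, b, C, ha, hAT⟩ := h 1 (fun _ => 1) le_rfl hli (isFreeKhovanskii_const_one 1)
  have ha1 : a < 1 := by norm_num at ha; linarith
  exact not_approxTypeAt_const_one 1 a b C ha1 hAT

/-- **`LinearIndependent ℚ s` is load-bearing:** with it dropped the crux fails at `n = 2`,
`s = (1, 1)` (a non-degenerate zero of `z₁ − 1 = z₂ − 1 = 0`), `θ = (1, 1, e, e)`: every `a < 1`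
is beaten by the diagonal challengers `(1, 1, α, α)` of Diaz's theorem. ANY PROOF of the crux must
use linear independence — and use it to produce two independent transcendental directions among
the coordinates of `θ` (one direction always loses to Diaz). -/
theorem khovanskiiApproxType_false_without_linIndep : ¬ KhovanskiiApproxTypeWithoutLinIndep := by
  intro h
  obtain ⟨a, b, C, ha, hAT⟩ := h 2 (fun _ => 1) le_rfl (isFreeKhovanskii_const_one 2)
  have ha1 : a < 1 := by norm_num at ha; linarith
  exact not_approxTypeAt_const_one 2 a b C ha1 hAT

end Summit.Schanuel.Schanuel.Cruxes.KhovanskiiApproxType.Negative
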